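import Summits.QuantumFields.YangMills.Theorems.BalabanUVNodesK0RecordFormatNamesLemmas9
import Summits.QuantumFields.YangMills.Theorems.BalabanUVNodesK0RecordFormatNamesLemmas11
import Summits.QuantumFields.YangMills.Theorems.BalabanUVNodesPortU8WindowDomains
import Summits.QuantumFields.YangMills.Theorems.BalabanUVNodesPortS1Selector
import Summits.QuantumFields.YangMills.Theorems.UnitScaleTiltProp8FlatPortChart
import Literature.MathematicalPhysics.QuantumFieldTheory.Balaban1983to89.B5Prop11FlatSliceCurlCoercivity

/-!
# PORT order O-Tok182 (docket O-10) — THE IDENTIFICATION TOKEN Tok-182 OF 27931 v11-G₄ READ AT THE WHOLE TORUS: `windowDomains … Finset.univ` IS the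
# [B6] whole-torus family `Domains.whole (k+1)`; the straight `(k+1)`-fold mean of the chart-unit localized response reproduces `ξ ×` its datum; the (21)-Landau
# re-gauging `recordHr` of the rooted response `recordD` has the SAME straight `(k+1)`-fold means as `recordD`; hence the NECESSARY CONDITION
# «Tok-182 ⟹ `Q_{k+1}(recordD_{a,(μ,y)}) = ξ·ρ₈(bV a)·𝟙_{⟨y,μ⟩}`» and its contrapositive (the refutation road BY NAME)

Cell `ym-nodeO-ideate` ∕ `ym-balaban-port`, porter lineage `ymgap-nodeO-port-PTZ-1` (gen 4, HELPER MODE), director-ym №504 (c) ∕ №505 (2), port-lead docket O-10.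
`--supports stmt-QuantumFields-27931 --as helper` (never `--workitem`).  [I] = [Balaban1987RG1], [B5] = [Balaban1984PropagatorsI], [B6] = [Balaban1984PropagatorsII],
[B7] = [Balaban1985Averaging], [15] = [Balaban1985Variational].

THE TOKEN (`nodeO-cover/CRIT-1-Tok182-v1.txt` f55bbcaced52e485, the displayed hypothesis `hL.2.1` of 27931 v11-G₄ bca3cb0d9af367ce): for every `k n ε₂₉ a μ y b`,
`recordHr F θ k K a (μ, y) b = recordHrLocξ F θ k K Finset.univ a (μ, y) b` (`θ := thetaFill F a₀ ε₂₉`, `K := recordK₀ F Mc k + n`) — the (21)-Landau representative of the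
ROOTED response `recordD` (the `B`-derivative at `0` of the matrix entries of `UkSel … (unitField B)`) against `ξ·H(e_{⟨y,μ⟩})·ρ₈(bV a)` with `H = GQ*(QGQ*)⁻¹` THE [B6] (2.35)
critical configuration of the window family at `W = univ`.

WHAT THIS FILE PROVES (theorems only; 0 `def ∕ instance ∕ notation ∕ sorry`; standard axioms), on the standing range `k + 1 ≤ m + K`:
* §1 `windowDomains_univ_Om`, ★ `windowDomains_univ_eq_whole` (via ust's `FlatPortChart.domains_ext`: a `Domains` is determined by `k` and `Om`): DEF-1's ed.16 window family AT `univ` IS r03's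
  whole-torus family `B6SectADomainsV1.Domains.whole (k+1)` — so every `B6SectAWholeTorusBridge` identity applies to it (`Λ_j = ∅` for `j ≤ k`, `Λ_{k+1} = T^{(k+1)}`, `N(Q′) =
  N(Q′_{k+1})`, (2.35) `= H_{k+1}`): the answer to №504 (c)'s first question «is `windowDomains … univ` the whole torus domain» is YES, in kernel.
* §2 ★ `bondAvgIter_windowResp_univ`: `Q_{k+1}(windowResp … univ l)(c) = [c = ⟨l₂, l₁⟩]` — the scalar whole-torus response REPRODUCES ITS DATUM under the STRAIGHT `(k+1)`-fold
  block mean `bondAvgIter (k+1)` ([B5] (1.18)) — from `(isCritical_hOp_V1 …).1.1` and PTB-1's `QE_windowDomains_eq_windowSrc_iff`; ★ `bondAvgIter_recordHrLocξ_univ`: entrywise,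
  `Q_{k+1}(recordHrLocξ … univ a l · i i′)(c) = [c = ⟨l₂, l₁⟩]·ξ·ρ₈(bV a)_{ii′}` (`ξ = eta (k+1)`; the answer to the second question: the `ξ` sits where CRIT-1 says).
* §3 `siteAvgIter_landauPotC_eq_zero` (the complex Landau potential has vanishing `(k+1)`-block means) and ★ `bondAvgIter_recordHr_eq_recordD`: THE (21)-LANDAU RE-GAUGING
  PRESERVES THE STRAIGHT `(k+1)`-FOLD MEANS — `Q_{k+1}(recordHr a l · i i′) = Q_{k+1}(recordD a l · i i′)` ([B5] (1.20) `Q_k∂ = ∂Q′_k`, the tree's `bondAvgIter_grad`, at a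
  potential with `Q′_{k+1} = 0`).
* §4 ★★ `straightMean_recordD_of_tok182At` ∕ `straightMean_recordD_of_tok182`: **Tok-182 (at one `(θ, K, a, l)`, resp. VERBATIM as cut) ⟹ `Q_{k+1}(recordD_{a,(μ,y)} · i i′)(c) =
  [c = ⟨y, μ⟩]·ξ·ρ₈(bV a)_{ii′}`** — the straight `(k+1)`-fold mean of the ROOTED response would have to reproduce `ξ ×` its datum; contrapositives `not_tok182At_of_straightMean_ne` ∕
  `not_tok182_of_straightMean_ne` (ONE coarse bond `c` and ONE entry where the straight mean of `recordD` is not `ξ ×` datum refutes the token).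

WHY THIS IS THE LOCATED RESIDUE OF Tok-182 (reading; nothing below is asserted in kernel).  `recordD` differentiates the constraint `Averaging.iter (avOfRecord F 2 K) (k+1)
(recordBgField … B) = unitField … B` (`Node00.isBackground_UkSel`), and `avOfRecord = blockAvg expMeanLogSU` is [I] (0.4) with staircases from the block CENTRES, whose flat
linearisation the tree certifies per level as `BlockAveragingEMLLinearised.linAvg_eq_bondAvg_sub_grad_combMean`: `Q₁Y(c) = L·bondAvg Y(c) − (combMean Y c₊ − combMean Y c₋)`
— the STRAIGHT mean MINUS the coarse gradient of the block-averaged comb potential ([B7] Prop. 3 (125): the main term acts on the radial-axial representative `R_{0,c₋}A`).  So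
the rooted response obeys `ξ⁻¹·Q_{k+1}(recordD) − ∂^{(k+1)}Λ̄(recordD) = datum`, and §4 says Tok-182 forces `∂^{(k+1)}Λ̄(recordD) = 0` — an identity with no source in print;
in the exact finite model of this seat's memo (`pub/ym-nodeO-ideate/ymgap-nodeO-port-PTZ-1/O-Tok182-MEMO-v1.md`) the two sides of Tok-182 are gauge-equivalent minimisers in
DIFFERENT `Q`-fibres (relative sup-discrepancy 0.39–0.51).  The kernel does not refute Tok-182 here: `recordD` has no closed form in the tree (its differentiability is 27931's
displayed HypAn).

HONEST FRAMING.  Bookkeeping over DEF-1's ed.14∕16∕16c names, r03's [B6] Sect. A files and PTB-1's window-domain file; nothing of Bałaban asserted, ported, discharged or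
refuted; 27931 SIGNED v11-G₄ · OPEN · UNPROVED; 27930⁸∕26648 SIGNED·OPEN; K0⁷ OPEN; NODE O 0∕1; COUNT 8∕28 · K 1∕4 UNMOVED; finite `𝕋⁴_{L^K}` at fixed ε — NOT continuum ∕
OS ∕ Clay; **the Yang–Mills mass gap (Clay) is NOT proved by any of this.**
-/

noncomputable section

open scoped BigOperators

namespace Summit.QuantumFields.YangMills.Theorems.PortTok182

open Literature.MathematicalPhysics.QuantumFieldTheory.Balaban1983to89
open Literature.MathematicalPhysics.QuantumFieldTheory.Balaban1983to89.Node00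
open Literature.MathematicalPhysics.QuantumFieldTheory.Balaban1983to89.T4Continuum (T4Family)
open Literature.MathematicalPhysics.QuantumFieldTheory.Balaban1983to89.LatticeFieldCalculus (siteAvgIter bondAvgIter grad)
open Literature.MathematicalPhysics.QuantumFieldTheory.Balaban1983to89.B6SectADomainsV1 (Domains)
open Literature.MathematicalPhysics.QuantumFieldTheory.Balaban1983to89.B6SectAOperatorsV1 (QE QsE BondIdx)
open Literature.MathematicalPhysics.QuantumFieldTheory.Balaban1983to89.B6SectAVectorModelV1 (GE EE)
open Literature.MathematicalPhysics.QuantumFieldTheory.BalabanImbrieJaffe1984to88.BIJ85AxialPropagator411 (BondSpace bondAvgIter_add)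
open Literature.MathematicalPhysics.QuantumFieldTheory.BalabanImbrieJaffe1984to88.BIJ85GaugeFunction5113 (siteAvgIter_add)
open Literature.MathematicalPhysics.QuantumFieldTheory.Balaban1983to89.B5Eq120IterProof (bondAvgIter_grad)
open Literature.MathematicalPhysics.QuantumFieldTheory.Balaban1983to89.B5Eq118OneStroke (siteAvgIter_eq_blockSum)
open Literature.MathematicalPhysics.QuantumFieldTheory.Balaban1983to89.B5Prop11FlatSliceCurlCoercivity (map_bondAvgIter)
open Summit.QuantumFields.YangMills.Theorems.K0RecordFormatNames
open Summit.QuantumFields.YangMills.Theorems.PortU8 (QE_windowDomains_eq_windowSrc_iff)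

variable (F : T4Family)

/-! ## §1  `windowDomains … univ` IS the whole-torus family `Domains.whole (k+1)` -/

/-- The window family at `W = univ`, unfolded: `Ω_j = T^{(j)}` for `j ≤ k + 1`, `∅` above. [cite: Balaban1984PropagatorsII, (2.1) p.224; Balaban1987RG1, p.275 L5–8] -/
theorem windowDomains_univ_Om {k K : ℕ} (hk : k + 1 ≤ (F.P K).m + (F.P K).K) (j : ℕ) :
    (windowDomains F k K hk Finset.univ).Om j = if j ≤ k + 1 then Finset.univ else ∅ := by
  by_cases hj0 : j = 0
  · subst hj0; simp [windowDomains]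
  · by_cases hj : j ≤ k + 1
    · ext y; simp [windowDomains, hj0, hj]
    · simp [windowDomains, hj0, hj]

/-- ★ **`windowDomains F k K hk Finset.univ = Domains.whole (k + 1) hk`** — DEF-1's ed.16 window family at the whole window IS r03's whole-torus family ([B6] p. 224 «we admit the
case when some domains Ω_j are equal to T_η»): `Λ_j = ∅` for `j ≤ k`, `Λ_{k+1} = T^{(k+1)}`, and every `B6SectAWholeTorusBridge` identity applies (`lamBond_whole_iff`,
`inGauge_whole_iff`, `hOp_whole_eq_Hk`, `existsUnique_landauGauge`, …). [cite: Balaban1984PropagatorsII, (2.1) p.224; Balaban1984PropagatorsI, (1.18) p.20] -/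
theorem windowDomains_univ_eq_whole {k K : ℕ} (hk : k + 1 ≤ (F.P K).m + (F.P K).K) :
    windowDomains F k K hk Finset.univ = Domains.whole (k + 1) hk :=
  FlatPortChart.domains_ext rfl (funext fun j => by rw [windowDomains_univ_Om]; rfl)

/-! ## §2  The whole-torus response reproduces its datum under the STRAIGHT `(k+1)`-fold mean -/

/-- ★ **`Q_{k+1}(windowResp … univ l)(c) = [c = ⟨l₂, l₁⟩]`**: the scalar whole-torus response `H e_l` ((2.35) at `windowDomains … univ`) reproduces its datum under the straight
`(k+1)`-fold block mean `bondAvgIter (k+1)` of [B5] (1.18) — the admissibility clause `QA = B` of the unique critical configuration, read through PTB-1's unfolding of the window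
family's `Q`. [cite: Balaban1984PropagatorsII, (2.6) p.224, (2.35) p.228; Balaban1984PropagatorsI, (1.18) p.20] -/
theorem bondAvgIter_windowResp_univ {k K : ℕ} (hk : k + 1 ≤ (F.P K).m + (F.P K).K) (l : RespLabel F k K) (c : PBond (F.P K) (k + 1)) :
    bondAvgIter (k + 1) (windowResp F k K Finset.univ l) c = if c = ⟨l.2, l.1⟩ then 1 else 0 := by
  classical
  have hw : ∀ _ : BondIdx (windowDomains F k K hk Finset.univ), (0 : ℝ) < 1 := fun _ => one_pos
  have hQ := (B6SectACriticalPointV1.isCritical_hOp_V1 (windowDomains F k K hk Finset.univ) (one_ne_zero (α := ℝ)) hw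
    (windowSrc F k K hk Finset.univ l)).1.1
  have key := ((QE_windowDomains_eq_windowSrc_iff F hk Finset.univ l _).1 hQ).2 c (Or.inl (Finset.mem_univ _))
  have hfun : windowResp F k K Finset.univ l =
      WithLp.ofLp (B6SectA.hOp (GE (windowDomains F k K hk Finset.univ) (one_ne_zero (α := ℝ)) hw) (QsE (windowDomains F k K hk Finset.univ))
        (EE (windowDomains F k K hk Finset.univ) (one_ne_zero (α := ℝ)) hw) (windowSrc F k K hk Finset.univ l)) := by
    funext b
    unfold windowResp
    rw [dif_pos hk]
  rw [hfun]
  exact key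

/-- ★ **Entrywise, in chart units**: `Q_{k+1}(recordHrLocξ … univ a l · i i′)(c) = [c = ⟨l₂, l₁⟩]·ξ·ρ₈(bV a)_{ii′}`, `ξ = eta (k+1) = L^{−(k+1)}` — the straight `(k+1)`-fold mean of
the chart-unit whole-torus localized response reproduces `ξ ×` its datum (CRIT-1's unit bookkeeping, №505 (2), in kernel for the right-hand side of Tok-182).
[cite: Balaban1987RG1, (1.1) p.260, (3.37) p.277, (4.35) p.290; Balaban1984PropagatorsII, (2.35) p.228] -/
theorem bondAvgIter_recordHrLocξ_univ (θ : Stage13Params F 2) {k K : ℕ} (hk : k + 1 ≤ (F.P K).m + (F.P K).K) (a : θ.ιβ) (l : RespLabel F k K)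
    (c : PBond (F.P K) (k + 1)) (i i' : Fin 2) :
    bondAvgIter (k + 1) (fun b => recordHrLocξ F θ k K Finset.univ a l b i i') c =
      if c = ⟨l.2, l.1⟩ then (letI := θ.instVβ₁; letI := θ.instVβ₂; ((F.P K).eta (k + 1) : ℂ) * θ.ρ8 (θ.bV a) i i') else 0 := by
  letI := θ.instVβ₁; letI := θ.instVβ₂
  set z₀ : ℂ := ((F.P K).eta (k + 1) : ℂ) * θ.ρ8 (θ.bV a) i i' with hz₀
  have hfield : (fun b => recordHrLocξ F θ k K Finset.univ a l b i i') =
      fun b => LinearMap.toSpanSingleton ℝ ℂ z₀ (windowResp F k K Finset.univ l b) := by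
    funext b
    rw [LinearMap.toSpanSingleton_apply, Complex.real_smul, recordHrLocξ_apply]
    simp only [recordHrLoc, hz₀]
    ring
  rw [hfield, ← map_bondAvgIter _ hk, bondAvgIter_windowResp_univ F hk l c, LinearMap.toSpanSingleton_apply]
  split_ifs <;> simp

/-! ## §3  The (21)-Landau re-gauging preserves the straight `(k+1)`-fold means -/

/-- `siteAvgIter` commutes with linear maps of the values (it is a finite linear combination of the values). [cite: Balaban1984PropagatorsI, (1.20) p.20 (bookkeeping)] -/
theorem map_siteAvgIter {P : Params} {V V' : Type*} [AddCommGroup V] [Module ℝ V] [AddCommGroup V'] [Module ℝ V'] (φ : V →ₗ[ℝ] V')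
    {j : ℕ} (hj : j ≤ P.m + P.K) (lam : Site P 0 → V) (y : Site P j) :
    φ (siteAvgIter j lam y) = siteAvgIter j (fun x => φ (lam x)) y := by
  rw [siteAvgIter_eq_blockSum j hj, siteAvgIter_eq_blockSum j hj, map_smul, map_sum]

/-- The complex (entrywise) Landau potential has vanishing `(k+1)`-fold block means (both its real and imaginary parts are `landauPot`s, [B6] (2.12) `λ₀ ∈ N(Q′)`).
[cite: Balaban1984PropagatorsII, (2.10)–(2.12) p.225; Balaban1985Variational, (21) p.281] -/
theorem siteAvgIter_landauPotC_eq_zero {k K : ℕ} (hk : k + 1 ≤ (F.P K).m + (F.P K).K) (x : PBond (F.P K) 0 → ℂ) :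
    siteAvgIter (k + 1) (landauPotC F k K x) = 0 := by
  have h1 := (landauPot_spec F hk (reBond F K x)).1
  have h2 := (landauPot_spec F hk (imBond F K x)).1
  have e : landauPotC F k K x = (fun y => Complex.ofRealCLM.toLinearMap (WithLp.ofLp (landauPot F k K (reBond F K x)) y)) +
      fun y => LinearMap.toSpanSingleton ℝ ℂ Complex.I (WithLp.ofLp (landauPot F k K (imBond F K x)) y) := by
    funext y
    simp [landauPotC, Complex.real_smul]
  rw [e, siteAvgIter_add]
  funext y
  rw [Pi.add_apply, Pi.zero_apply, ← map_siteAvgIter _ hk, ← map_siteAvgIter _ hk, h1, h2]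
  simp

/-- ★ **THE (21)-LANDAU RE-GAUGING PRESERVES THE STRAIGHT `(k+1)`-FOLD MEANS**: `Q_{k+1}(recordHr a l · i i′) = Q_{k+1}(recordD a l · i i′)` for every coarse bond and every matrix
entry — `recordD = recordHr + ∂(landauPotC ∘ recordD)` (`recordD_eq_recordHr_add`), [B5] (1.20) `Q_{k+1}∂λ = ∂Q′_{k+1}λ` (`bondAvgIter_grad`), and `Q′_{k+1}(landauPotC) = 0`.
In words: `landauRepC` moves the rooted response INSIDE its `Q_{k+1}`-fibre. [cite: Balaban1984PropagatorsI, (1.20) p.20; Balaban1985Variational, (21) p.281; Balaban1984PropagatorsII, (2.12) p.225] -/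
theorem bondAvgIter_recordHr_eq_recordD (θ : Stage13Params F 2) {k K : ℕ} (hk : k + 1 ≤ (F.P K).m + (F.P K).K) (a : θ.ιβ) (l : RespLabel F k K)
    (c : PBond (F.P K) (k + 1)) (i i' : Fin 2) :
    bondAvgIter (k + 1) (fun b => recordHr F θ k K a l b i i') c = bondAvgIter (k + 1) (fun b => recordD F θ k K a l b i i') c := by
  have hdec : (fun b => recordD F θ k K a l b i i') =
      (fun b => recordHr F θ k K a l b i i') + grad 1 (landauPotC F k K fun b' => recordD F θ k K a l b' i i') := by
    funext b
    rw [Pi.add_apply, recordD_eq_recordHr_add F θ k K a l b i i']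
    simp only [grad, one_smul]
  rw [hdec, bondAvgIter_add, bondAvgIter_grad (k + 1) hk 1 _, siteAvgIter_landauPotC_eq_zero F hk]
  simp [grad]

/-! ## §4  THE NECESSARY CONDITION: Tok-182 ⟹ the straight `(k+1)`-fold mean of the ROOTED response reproduces `ξ ×` its datum -/

section Theta

variable (θ : Stage13Params F 2)

/-- ★★ **Tok-182 AT ONE `(θ, K, a, l)` ⟹ `Q_{k+1}(recordD_{a,l} · i i′)(c) = [c = ⟨l₂, l₁⟩]·ξ·ρ₈(bV a)_{ii′}`** for every coarse bond `c` and every entry: if the (21)-Landau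
representative of the rooted response equals the chart-unit whole-torus localized response, then the STRAIGHT `(k+1)`-fold block mean of the rooted response itself reproduces
`ξ ×` its datum (§3 + §2).  The rooted response is the derivative of a configuration whose `(k+1)`-fold (0.4)-AVERAGE — not straight mean — is the datum; the tree's flat
linearisation of (0.4) is the straight mean minus a coarse gradient of comb means (`BlockAveragingEMLLinearised.linAvg_eq_bondAvg_sub_grad_combMean`), which is why this
condition is the located residue of the token. [cite: Balaban1985Variational, (182) p.307, (21) p.281; Balaban1985Averaging, (125) p.36; Balaban1984PropagatorsII, (2.35) p.228] -/
theorem straightMean_recordD_of_tok182At {k K : ℕ} (hk : k + 1 ≤ (F.P K).m + (F.P K).K) (a : θ.ιβ) (l : RespLabel F k K)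
    (h : ∀ (b : PBond (F.P K) 0), recordHr F θ k K a l b = recordHrLocξ F θ k K Finset.univ a l b) (c : PBond (F.P K) (k + 1)) (i i' : Fin 2) :
    bondAvgIter (k + 1) (fun b => recordD F θ k K a l b i i') c =
      if c = ⟨l.2, l.1⟩ then (letI := θ.instVβ₁; letI := θ.instVβ₂; ((F.P K).eta (k + 1) : ℂ) * θ.ρ8 (θ.bV a) i i') else 0 := by
  rw [← bondAvgIter_recordHr_eq_recordD F θ hk a l c i i',
    show (fun b => recordHr F θ k K a l b i i') = fun b => recordHrLocξ F θ k K Finset.univ a l b i i' from funext fun b => by rw [h b]]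
  exact bondAvgIter_recordHrLocξ_univ F θ hk a l c i i'

/-- **The refutation road BY NAME (one `(θ, K, a, l)`)**: ONE coarse bond and ONE matrix entry at which the straight `(k+1)`-fold mean of the rooted response is NOT `ξ ×` its
datum refutes Tok-182 at `(θ, K, a, l)`. [cite: Balaban1985Variational, (182) p.307; Balaban1985Averaging, (125) p.36] -/
theorem not_tok182At_of_straightMean_ne {k K : ℕ} (hk : k + 1 ≤ (F.P K).m + (F.P K).K) (a : θ.ιβ) (l : RespLabel F k K) (c : PBond (F.P K) (k + 1))
    (i i' : Fin 2) (hne : bondAvgIter (k + 1) (fun b => recordD F θ k K a l b i i') c ≠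
      if c = ⟨l.2, l.1⟩ then (letI := θ.instVβ₁; letI := θ.instVβ₂; ((F.P K).eta (k + 1) : ℂ) * θ.ρ8 (θ.bV a) i i') else 0) :
    ¬ ∀ (b : PBond (F.P K) 0), recordHr F θ k K a l b = recordHrLocξ F θ k K Finset.univ a l b :=
  fun h => hne (straightMean_recordD_of_tok182At F θ hk a l h c i i')

end Theta

/-- ★★ **Tok-182 VERBATIM AS CUT (`nodeO-cover/CRIT-1-Tok182-v1.txt` f55bbcaced52e485 = 27931 v11-G₄'s `hL.2.1`) ⟹ on every member `K = recordK₀ F Mc k + n`, every colour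
`a`, every source `(μ, y)`, every coarse bond `c` and entry `(i, i′)`: `Q_{k+1}(recordD · i i′)(c) = [c = ⟨y, μ⟩]·ξ·ρ₈(bV a)_{ii′}`** — the straight `(k+1)`-fold mean of the
ROOTED response reproduces `ξ ×` its datum.  A consumer holding `hL.2.1` gets this for free; a refuter needs one `(k, n, ε₂₉, a, μ, y, c, i, i′)` where it fails
(`not_tok182_of_straightMean_ne`). [cite: Balaban1985Variational, (182) p.307, (21) p.281; Balaban1985Averaging, (125) p.36; Balaban1984PropagatorsII, (2.35) p.228] -/
theorem straightMean_recordD_of_tok182 (Mc : ℕ) (a₀ : ℝ)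
    (h : ∀ (k n : ℕ) (ε₂₉ : ℝ), 0 < ε₂₉ → letI θ := thetaFill F a₀ ε₂₉; letI := θ.instVβ₁; letI := θ.instVβ₂; letI := θ.instιβ;
      ∀ (a : θ.ιβ) (μ : Fin (F.P (recordK₀ F Mc k + n)).d) (y : Site (F.P (recordK₀ F Mc k + n)) (k + 1)),
      ∀ b : PBond (F.P (recordK₀ F Mc k + n)) 0,
        recordHr F θ k (recordK₀ F Mc k + n) a (μ, y) b = recordHrLocξ F θ k (recordK₀ F Mc k + n) Finset.univ a (μ, y) b)
    (k n : ℕ) (ε₂₉ : ℝ) (hε : 0 < ε₂₉) (a : (thetaFill F a₀ ε₂₉).ιβ) (μ : Fin (F.P (recordK₀ F Mc k + n)).d)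
    (y : Site (F.P (recordK₀ F Mc k + n)) (k + 1)) (c : PBond (F.P (recordK₀ F Mc k + n)) (k + 1)) (i i' : Fin 2) :
    bondAvgIter (k + 1) (fun b => recordD F (thetaFill F a₀ ε₂₉) k (recordK₀ F Mc k + n) a (μ, y) b i i') c =
      if c = ⟨y, μ⟩ then (letI θ := thetaFill F a₀ ε₂₉; letI := θ.instVβ₁; letI := θ.instVβ₂;
        ((F.P (recordK₀ F Mc k + n)).eta (k + 1) : ℂ) * θ.ρ8 (θ.bV a) i i') else 0 :=
  straightMean_recordD_of_tok182At F (thetaFill F a₀ ε₂₉) (BalabanUVNodesPortS1.succ_le_m_add_K_recordK₀ F Mc k n) a (μ, y) (h k n ε₂₉ hε a μ y) c i i'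

/-- **The refutation road BY NAME (token level)**: ONE index `(k, n, ε₂₉ > 0, a, μ, y, c, i, i′)` at which the straight `(k+1)`-fold mean of the rooted response is NOT `ξ ×`
its datum refutes Tok-182 as cut — and with it makes 27931 v11-G₄ vacuously true (director-ym №496∕№504 (c) closure-rule path; nothing of the kind is asserted here).
[cite: Balaban1985Variational, (182) p.307; Balaban1985Averaging, (125) p.36] -/
theorem not_tok182_of_straightMean_ne (Mc : ℕ) (a₀ : ℝ) (k n : ℕ) (ε₂₉ : ℝ) (hε : 0 < ε₂₉) (a : (thetaFill F a₀ ε₂₉).ιβ)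
    (μ : Fin (F.P (recordK₀ F Mc k + n)).d) (y : Site (F.P (recordK₀ F Mc k + n)) (k + 1)) (c : PBond (F.P (recordK₀ F Mc k + n)) (k + 1)) (i i' : Fin 2)
    (hne : bondAvgIter (k + 1) (fun b => recordD F (thetaFill F a₀ ε₂₉) k (recordK₀ F Mc k + n) a (μ, y) b i i') c ≠
      if c = ⟨y, μ⟩ then (letI θ := thetaFill F a₀ ε₂₉; letI := θ.instVβ₁; letI := θ.instVβ₂;
        ((F.P (recordK₀ F Mc k + n)).eta (k + 1) : ℂ) * θ.ρ8 (θ.bV a) i i') else 0) :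
    ¬ ∀ (k n : ℕ) (ε₂₉ : ℝ), 0 < ε₂₉ → letI θ := thetaFill F a₀ ε₂₉; letI := θ.instVβ₁; letI := θ.instVβ₂; letI := θ.instιβ;
      ∀ (a : θ.ιβ) (μ : Fin (F.P (recordK₀ F Mc k + n)).d) (y : Site (F.P (recordK₀ F Mc k + n)) (k + 1)),
      ∀ b : PBond (F.P (recordK₀ F Mc k + n)) 0,
        recordHr F θ k (recordK₀ F Mc k + n) a (μ, y) b = recordHrLocξ F θ k (recordK₀ F Mc k + n) Finset.univ a (μ, y) b :=
  fun h => hne (straightMean_recordD_of_tok182 F Mc a₀ h k n ε₂₉ hε a μ y c i i')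

end Summit.QuantumFields.YangMills.Theorems.PortTok182

end
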